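import Summits.ResolutionOfSingularities.ResolutionOfSingularities.Theorems.HomologicalConductorNoZenoSpecResidueField
import HarnessLib

/-!
# Crux `NoZenoR` / `NoZeno` (stmt-ResolutionOfSingularities-19943 / -16483), β2 descent, `stub_L1wCore` (F1) route,
# D2 glue: the CHOICE of the splitting residue field and the splitting hypothesis `hsplit` of BC-2c

OURS (cell res-hironaka, chain W4.4; stub worker res-L0-w44-stub-2 g12; brick DAG `L1W-PREP-v3.md` 163c41d224043713
§0/§1 «D2 glue»).  Glue between the scheme-level bricks BC-2 / BC-2c (`…NoZenoSplitCountBaseChange`,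
`…NoZenoSplitCountSplitting`) and the ring-level splitting base (res-D-pv-039's BC-0
`exists_adjoinRoot_normal_splittingBase`, which takes ANY finite separable `κ₁` over `IsLocalRing.ResidueField D` and
returns `f` with `ResidueField (AdjoinRoot f) ≃ₐ[ResidueField D] κ₁`).  Nothing here is a statement of the manuscript
under review (Hironaka 2017); AI-written, weaker than expert review.

* `minpoly_map_ringEquiv` — the minimal polynomial under an isomorphism of the base field;
* **`exists_finite_normal_splits`** — a finite family of finite separable extensions of a field `κ` is split by ONE
  finite separable NORMAL extension `κ₁ ⊆ κ^alg` (the normal closure of the compositum of their images);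
* `Γevaluation_residueFieldCongr`, `exists_residueFieldIso_compat` — bookkeeping: the LINK isomorphism
  `κ(𝔪_S) ≅ ResidueField S` can be chosen compatible with ANY prescribed `κ(g 𝔪_S) ≅ ResidueField R`;
* **`exists_splittingField`** — for `π : X → Spec D` (`D` local) and a finite set `S` of points of the closed fibre
  with honest weights (`[κ(η)^s : κ(π η)] < ∞`), there is a finite separable `κ₁/ResidueField D` such that for EVERY
  local `D`-algebra `B` with `ResidueField B ≃ₐ[ResidueField D] κ₁` (e.g. `B = D[X]/(f)` from BC-0) the hypothesis
  `hsplit` of `ncard_excCurvePoints_pullback_snd` holds at every `η ∈ S`: `κ(𝔪_B)` splits the separable constant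
  field `κ(η)^s` (structure map `κ(π η) ≅ κ(g 𝔪_B) → κ(𝔪_B)` exactly as in BC-2c).
-/

noncomputable section

-- single-problem summit: the doubled namespace component `ResolutionOfSingularities` is forced
set_option linter.dupNamespace false

namespace Summit.ResolutionOfSingularities.ResolutionOfSingularities.Theorems.NoZeno.ExcCount

open CategoryTheory AlgebraicGeometry IsLocalRing Polynomial IntermediateField

universe u v w

/-! ## Algebra: one finite normal separable extension splitting a finite family -/

section Algebra

/-- **The minimal polynomial under an isomorphism of base fields**: for `K₁ ≃ K₂` compatible with the structure maps
into `E`, `(minpoly K₁ x).map u = minpoly K₂ x`. [folklore] -/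
theorem minpoly_map_ringEquiv {K₁ K₂ E : Type*} [Field K₁] [Field K₂] [Field E] [Algebra K₁ E] [Algebra K₂ E]
    (u : K₁ ≃+* K₂) (hu : ∀ a, algebraMap K₂ E (u a) = algebraMap K₁ E a) (x : E) (hx : IsIntegral K₁ x) :
    (minpoly K₁ x).map u.toRingHom = minpoly K₂ x := by
  refine minpoly.eq_of_irreducible_of_monic ?_ ?_ ((minpoly.monic hx).map _)
  · have h : Irreducible (Polynomial.mapEquiv u (minpoly K₁ x)) :=
      (MulEquiv.irreducible_iff (Polynomial.mapEquiv u)).mpr (minpoly.irreducible hx)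
    simpa [Polynomial.mapEquiv_apply] using h
  · have hcomp : (algebraMap K₂ E).comp u.toRingHom = algebraMap K₁ E := RingHom.ext fun a => hu a
    rw [Polynomial.aeval_def, Polynomial.eval₂_map, hcomp]
    exact minpoly.aeval K₁ x

/-- **A finite family of finite separable extensions is split by one finite separable normal extension**: for
finitely many fields `L i`, finite and separable over `κ` through prescribed structure maps, there is a finite
separable normal `κ₁ ⊆ κ^alg` over `κ` in which the minimal polynomial over `κ` of every element of every `L i`
splits (the normal closure of the compositum of the images of the `L i` in an algebraic closure). [folklore] -/
theorem exists_finite_normal_splits {κ : Type u} [Field κ] {ι : Type v} [Finite ι] (L : ι → Type w)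
    [∀ i, Field (L i)] (alg : ∀ i, κ →+* L i)
    (hfin : ∀ i, letI := (alg i).toAlgebra; FiniteDimensional κ (L i))
    (hsep : ∀ i, letI := (alg i).toAlgebra; Algebra.IsSeparable κ (L i)) :
    ∃ κ₁ : IntermediateField κ (AlgebraicClosure κ),
      FiniteDimensional κ κ₁ ∧ Algebra.IsSeparable κ κ₁ ∧ Normal κ κ₁ ∧
        ∀ (i : ι) (x : L i), letI := (alg i).toAlgebra; ((minpoly κ x).map (algebraMap κ κ₁)).Splits := by
  letI : ∀ i, Algebra κ (L i) := fun i => (alg i).toAlgebra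
  haveI : ∀ i, FiniteDimensional κ (L i) := hfin
  haveI : ∀ i, Algebra.IsSeparable κ (L i) := hsep
  -- embed every `L i` into an algebraic closure `Ω` of `κ`
  let Ω := AlgebraicClosure κ
  let φ : ∀ i, L i →ₐ[κ] Ω := fun i => IsAlgClosed.lift
  -- the compositum `K₀` of the images: finite and separable over `κ`
  let K₀ : IntermediateField κ Ω := ⨆ i, (φ i).fieldRange
  haveI : ∀ i, FiniteDimensional κ (φ i).fieldRange := fun i =>
    LinearEquiv.finiteDimensional (φ i).equivFieldRange.toLinearEquiv
  haveI hK₀fin : FiniteDimensional κ K₀ := IntermediateField.finiteDimensional_iSup_of_finite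
  have hsepφ : ∀ i (x : L i), IsSeparable κ (φ i x) := by
    intro i x
    unfold IsSeparable
    rw [minpoly.algHom_eq (φ i) (φ i).injective x]
    exact Algebra.IsSeparable.isSeparable κ x
  have hK₀le : K₀ ≤ separableClosure κ Ω := by
    refine iSup_le fun i => ?_
    rintro y ⟨x, rfl⟩
    exact mem_separableClosure_iff.mpr (by change IsSeparable κ (φ i x); exact hsepφ i x)
  haveI hK₀sep : Algebra.IsSeparable κ K₀ := (le_separableClosure_iff κ Ω K₀).mp hK₀le
  -- its normal closure `κ₁`
  let κ₁ : IntermediateField κ Ω := normalClosure κ K₀ Ω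
  haveI hnorm : Normal κ κ₁ := normalClosure.normal κ K₀ Ω
  haveI hfin₁ : FiniteDimensional κ κ₁ := normalClosure.is_finiteDimensional κ K₀ Ω
  have hle₁ : κ₁ ≤ separableClosure κ Ω := by
    refine normalClosure_le_iff.mpr fun f => ?_
    rintro y ⟨z, rfl⟩
    refine mem_separableClosure_iff.mpr ?_
    change IsSeparable κ (f z)
    unfold IsSeparable
    rw [minpoly.algHom_eq f f.injective z]
    exact Algebra.IsSeparable.isSeparable κ z
  haveI hsep₁ : Algebra.IsSeparable κ κ₁ := (le_separableClosure_iff κ Ω κ₁).mp hle₁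
  refine ⟨κ₁, hfin₁, hsep₁, hnorm, fun i x => ?_⟩
  -- `φ i x ∈ K₀ ≤ κ₁`, and `κ₁` is normal
  have hmem : φ i x ∈ κ₁ := IntermediateField.le_normalClosure K₀ (le_iSup (fun i => (φ i).fieldRange) i ⟨x, rfl⟩)
  have hspl := hnorm.splits (⟨φ i x, hmem⟩ : κ₁)
  have hmin : minpoly κ (⟨φ i x, hmem⟩ : κ₁) = minpoly κ x := by
    rw [← minpoly.algebraMap_eq (algebraMap κ₁ Ω).injective (⟨φ i x, hmem⟩ : κ₁)]
    exact minpoly.algHom_eq (φ i) (φ i).injective x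
  rwa [hmin] at hspl

end Algebra

/-! ## Bookkeeping: the LINK isomorphism with a prescribed isomorphism downstairs -/

section Link

/-- `Γevaluation` and `residueFieldCongr`. [folklore] -/
theorem Γevaluation_residueFieldCongr {X : Scheme.{u}} {x y : X} (h : x = y) :
    X.Γevaluation x ≫ (X.residueFieldCongr h).hom = X.Γevaluation y := by
  subst h
  simp [Scheme.residueFieldCongr_refl]

variable (R S : Type u) [CommRing R] [CommRing S] [IsLocalRing R] [IsLocalRing S] [Algebra R S]
  [IsLocalHom (algebraMap R S)]

/-- **The LINK square with a PRESCRIBED isomorphism downstairs**: for any `eR : κ(g 𝔪_S) ≅ ResidueField R` compatible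
with `R → κ(g 𝔪_S)` there is `eS : κ(𝔪_S) ≅ ResidueField S` compatible with `S → κ(𝔪_S)` and carrying
`g.residueFieldMap 𝔪_S` to `ResidueField R → ResidueField S` (`g = Spec (R → S)`). [folklore] -/
theorem exists_residueFieldIso_compat
    (eR : (Spec (.of R)).residueField ((Spec.map (CommRingCat.ofHom (algebraMap R S))).base (closedPoint S)) ≅
      CommRingCat.of (ResidueField R))
    (heR : (Scheme.ΓSpecIso (.of R)).inv ≫ (Spec (.of R)).Γevaluation
      ((Spec.map (CommRingCat.ofHom (algebraMap R S))).base (closedPoint S)) ≫ eR.hom = CommRingCat.ofHom (residue R)) :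
    ∃ eS : (Spec (.of S)).residueField (closedPoint S) ≅ CommRingCat.of (ResidueField S),
      (Scheme.ΓSpecIso (.of S)).inv ≫ (Spec (.of S)).Γevaluation (closedPoint S) ≫ eS.hom =
          CommRingCat.ofHom (residue S) ∧
      (Spec.map (CommRingCat.ofHom (algebraMap R S))).residueFieldMap (closedPoint S) ≫ eS.hom =
        eR.hom ≫ CommRingCat.ofHom (algebraMap (ResidueField R) (ResidueField S)) := by
  obtain ⟨eS, heS⟩ := exists_residueFieldIso_of_eq_closedPoint S (closedPoint S) rfl
  refine ⟨eS, heS, ?_⟩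
  haveI : ((Spec.map (CommRingCat.ofHom (algebraMap R S))).base (closedPoint S)).asIdeal.IsMaximal := by
    rw [specMap_closedPoint R S]; exact maximalIdeal.isMaximal R
  have hsurj := ΓtoResidueField_surjective_of_isMaximal R
    ((Spec.map (CommRingCat.ofHom (algebraMap R S))).base (closedPoint S))
  have h1 : (Scheme.ΓSpecIso (.of R)).inv ≫ (Spec (.of R)).Γevaluation
      ((Spec.map (CommRingCat.ofHom (algebraMap R S))).base (closedPoint S)) ≫
      (Spec.map (CommRingCat.ofHom (algebraMap R S))).residueFieldMap (closedPoint S) ≫ eS.hom =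
      CommRingCat.ofHom ((residue S).comp (algebraMap R S)) := by
    rw [Scheme.Γevaluation_naturality_assoc, ← Scheme.ΓSpecIso_inv_naturality_assoc, heS]
    rfl
  have h2 : (Scheme.ΓSpecIso (.of R)).inv ≫ (Spec (.of R)).Γevaluation
      ((Spec.map (CommRingCat.ofHom (algebraMap R S))).base (closedPoint S)) ≫
      eR.hom ≫ CommRingCat.ofHom (algebraMap (ResidueField R) (ResidueField S)) =
      CommRingCat.ofHom ((residue S).comp (algebraMap R S)) := by
    rw [reassoc_of% heR]
    rfl
  ext c
  obtain ⟨r, rfl⟩ := hsurj c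
  have h1' := congrArg (fun φ => φ.hom r) h1
  have h2' := congrArg (fun φ => φ.hom r) h2
  simp only [CommRingCat.hom_comp, RingHom.comp_apply] at h1' h2'
  change ((Spec.map (CommRingCat.ofHom (algebraMap R S))).residueFieldMap (closedPoint S) ≫ eS.hom).hom _ =
    (eR.hom ≫ _).hom _
  simp only [CommRingCat.hom_comp, RingHom.comp_apply]
  rw [h1', h2']

end Link

/-! ## The splitting residue field for finitely many points of the closed fibre -/

section Choice

variable {D : Type} [CommRing D] [IsLocalRing D] {X : Scheme.{0}} (π : X ⟶ Spec (.of D))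

/-- **D2 glue — the choice of the splitting residue field.** For `π : X → Spec D` (`D` local), a finite set `S` of
points of the closed fibre and honest weights there, there is a finite separable (normal) extension `κ₁` of
`ResidueField D` inside its algebraic closure such that, for EVERY local `D`-algebra `B` whose residue field is
`κ₁` over `ResidueField D` (as BC-0 provides) and every `η ∈ S`, the residue field `κ(𝔪_B)` — a `κ(π η)`-algebra
through `κ(π η) ≅ κ(g 𝔪_B) → κ(𝔪_B)`, `g = Spec (D → B)`, exactly as in `ncard_excCurvePoints_pullback_snd` — splits the
minimal polynomial of every element of the separable constant field `κ(η)^s = separableClosure κ(π η) κ(η)`.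
[this work] -/
theorem exists_splittingField (S : Set X) (hS : S.Finite) (hSπ : ∀ η ∈ S, π.base η = closedPoint D)
    (hFW : ∀ η ∈ S, letI := (π.residueFieldMap η).hom.toAlgebra
      FiniteDimensional ((Spec (.of D)).residueField (π.base η))
        (separableClosure ((Spec (.of D)).residueField (π.base η)) (X.residueField η))) :
    ∃ κ₁ : IntermediateField (ResidueField D) (AlgebraicClosure (ResidueField D)),
      FiniteDimensional (ResidueField D) κ₁ ∧ Algebra.IsSeparable (ResidueField D) κ₁ ∧
      ∀ (B : Type) [CommRing B] [IsLocalRing B] [Algebra D B] [IsLocalHom (algebraMap D B)]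
        (_ : ResidueField B ≃ₐ[ResidueField D] κ₁) (η : X) (_ : η ∈ S)
        (hy : (Spec.map (CommRingCat.ofHom (algebraMap D B))).base (closedPoint B) = π.base η),
        letI := (π.residueFieldMap η).hom.toAlgebra
        letI := (((Spec (.of D)).residueFieldCongr hy).inv ≫
          (Spec.map (CommRingCat.ofHom (algebraMap D B))).residueFieldMap (closedPoint B)).hom.toAlgebra
        ∀ x : separableClosure ((Spec (.of D)).residueField (π.base η)) (X.residueField η),
          ((minpoly ((Spec (.of D)).residueField (π.base η)) x).map
            (algebraMap ((Spec (.of D)).residueField (π.base η))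
              ((Spec (.of B)).residueField (closedPoint B)))).Splits := by
  haveI : Finite S := hS.to_subtype
  -- `κ(π η) → κ(η)` for every `η`, as a (local) family of instances
  letI instA : ∀ η : X, Algebra ((Spec (.of D)).residueField (π.base η)) (X.residueField η) := fun η =>
    (π.residueFieldMap η).hom.toAlgebra
  -- LINK at the closed point of `D`
  obtain ⟨ι₀, hι₀⟩ := exists_residueFieldIso_of_eq_closedPoint D (closedPoint D) rfl
  -- `κ(π η) ≅ ResidueField D` for `η ∈ S`
  let u : ∀ η : S, (Spec (.of D)).residueField (π.base (η : X)) ≃+* ResidueField D := fun η =>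
    ((Spec (.of D)).residueFieldCongr (hSπ η η.2)).commRingCatIsoToRingEquiv.trans ι₀.commRingCatIsoToRingEquiv
  -- structure maps `ResidueField D → κ(η)^s` through `u⁻¹`
  have hu : ∀ (η : S) (a : (Spec (.of D)).residueField (π.base (η : X))),
      ((algebraMap ((Spec (.of D)).residueField (π.base (η : X)))
        ↥(separableClosure ((Spec (.of D)).residueField (π.base (η : X))) (X.residueField (η : X)))).comp
        (u η).symm.toRingHom) (u η a) =
      algebraMap ((Spec (.of D)).residueField (π.base (η : X)))
        ↥(separableClosure ((Spec (.of D)).residueField (π.base (η : X))) (X.residueField (η : X))) a := by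
    intro η a
    change (algebraMap _ _) ((u η).symm (u η a)) = _
    rw [RingEquiv.symm_apply_apply]
  have hfin : ∀ η : S, letI := ((algebraMap ((Spec (.of D)).residueField (π.base (η : X)))
        ↥(separableClosure ((Spec (.of D)).residueField (π.base (η : X))) (X.residueField (η : X)))).comp
        (u η).symm.toRingHom).toAlgebra
      FiniteDimensional (ResidueField D)
        ↥(separableClosure ((Spec (.of D)).residueField (π.base (η : X))) (X.residueField (η : X))) := by
    intro η
    haveI : FiniteDimensional ((Spec (.of D)).residueField (π.base (η : X)))
        ↥(separableClosure ((Spec (.of D)).residueField (π.base (η : X))) (X.residueField (η : X))) := hFW η η.2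
    letI := ((algebraMap ((Spec (.of D)).residueField (π.base (η : X)))
        ↥(separableClosure ((Spec (.of D)).residueField (π.base (η : X))) (X.residueField (η : X)))).comp
        (u η).symm.toRingHom).toAlgebra
    exact Module.Finite.of_equiv_equiv (u η) (RingEquiv.refl _) (RingHom.ext fun a => hu η a)
  have hsep : ∀ η : S, letI := ((algebraMap ((Spec (.of D)).residueField (π.base (η : X)))
        ↥(separableClosure ((Spec (.of D)).residueField (π.base (η : X))) (X.residueField (η : X)))).comp
        (u η).symm.toRingHom).toAlgebra
      Algebra.IsSeparable (ResidueField D)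
        ↥(separableClosure ((Spec (.of D)).residueField (π.base (η : X))) (X.residueField (η : X))) := by
    intro η
    haveI : Algebra.IsSeparable ((Spec (.of D)).residueField (π.base (η : X)))
        ↥(separableClosure ((Spec (.of D)).residueField (π.base (η : X))) (X.residueField (η : X))) :=
      separableClosure.isSeparable _ _
    letI := ((algebraMap ((Spec (.of D)).residueField (π.base (η : X)))
        ↥(separableClosure ((Spec (.of D)).residueField (π.base (η : X))) (X.residueField (η : X)))).comp
        (u η).symm.toRingHom).toAlgebra
    exact Algebra.IsSeparable.of_equiv_equiv (u η) (RingEquiv.refl _) (RingHom.ext fun a => hu η a)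
  obtain ⟨κ₁, hfin₁, hsep₁, -, hsplits⟩ := exists_finite_normal_splits
    (fun η : S => ↥(separableClosure ((Spec (.of D)).residueField (π.base (η : X))) (X.residueField (η : X))))
    (fun η : S => (algebraMap ((Spec (.of D)).residueField (π.base (η : X)))
        ↥(separableClosure ((Spec (.of D)).residueField (π.base (η : X))) (X.residueField (η : X)))).comp
        (u η).symm.toRingHom) hfin hsep
  refine ⟨κ₁, hfin₁, hsep₁, ?_⟩
  intro B _ _ _ _ e₁ η hη hy
  letI := (π.residueFieldMap η).hom.toAlgebra
  letI iK := (((Spec (.of D)).residueFieldCongr hy).inv ≫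
    (Spec.map (CommRingCat.ofHom (algebraMap D B))).residueFieldMap (closedPoint B)).hom.toAlgebra
  intro x
  set g := Spec.map (CommRingCat.ofHom (algebraMap D B)) with hg
  -- the prescribed isomorphism `κ(g 𝔪_B) ≅ κ(𝔪_D) ≅ ResidueField D` and its compatible partner at `𝔪_B`
  let eR : (Spec (.of D)).residueField (g.base (closedPoint B)) ≅ CommRingCat.of (ResidueField D) :=
    (Spec (.of D)).residueFieldCongr (hy.trans (hSπ η hη)) ≪≫ ι₀
  have heR : (Scheme.ΓSpecIso (.of D)).inv ≫ (Spec (.of D)).Γevaluation (g.base (closedPoint B)) ≫ eR.hom =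
      CommRingCat.ofHom (residue D) := by
    change (Scheme.ΓSpecIso (.of D)).inv ≫ (Spec (.of D)).Γevaluation (g.base (closedPoint B)) ≫
      ((Spec (.of D)).residueFieldCongr (hy.trans (hSπ η hη))).hom ≫ ι₀.hom = _
    rw [← Category.assoc ((Spec (.of D)).Γevaluation _), Γevaluation_residueFieldCongr, hι₀]
  obtain ⟨eS, -, hsq⟩ := exists_residueFieldIso_compat D B eR heR
  -- the structure map `κ(π η) → κ(𝔪_B)` is `eS⁻¹ ∘ (ResidueField D → ResidueField B) ∘ u_η`
  have hchain : algebraMap ((Spec (.of D)).residueField (π.base η)) ((Spec (.of B)).residueField (closedPoint B)) =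
      eS.inv.hom.comp ((algebraMap (ResidueField D) (ResidueField B)).comp (u ⟨η, hη⟩).toRingHom) := by
    have hsq' : g.residueFieldMap (closedPoint B) =
        eR.hom ≫ CommRingCat.ofHom (algebraMap (ResidueField D) (ResidueField B)) ≫ eS.inv := by
      rw [← Category.assoc, ← hsq, Category.assoc, Iso.hom_inv_id, Category.comp_id]
    change (((Spec (.of D)).residueFieldCongr hy).inv ≫ g.residueFieldMap (closedPoint B)).hom = _
    rw [hsq']
    ext a
    change eS.inv.hom (algebraMap (ResidueField D) (ResidueField B)
      (ι₀.hom.hom (((Spec (.of D)).residueFieldCongr (hy.trans (hSπ η hη))).hom.hom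
        (((Spec (.of D)).residueFieldCongr hy).inv.hom a)))) =
      eS.inv.hom (algebraMap (ResidueField D) (ResidueField B)
        (ι₀.hom.hom (((Spec (.of D)).residueFieldCongr (hSπ η hη)).hom.hom a)))
    congr 3
    rw [← CommRingCat.comp_apply, Scheme.residueFieldCongr_inv, Scheme.residueFieldCongr_trans_hom]
  -- the minimal polynomial over `ResidueField D` (through `u⁻¹`) is the `u`-image of the one over `κ(π η)`
  letI := ((algebraMap ((Spec (.of D)).residueField (π.base η))
      ↥(separableClosure ((Spec (.of D)).residueField (π.base η)) (X.residueField η))).comp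
      (u ⟨η, hη⟩).symm.toRingHom).toAlgebra
  haveI : FiniteDimensional ((Spec (.of D)).residueField (π.base η))
      ↥(separableClosure ((Spec (.of D)).residueField (π.base η)) (X.residueField η)) := hFW η hη
  have hint : IsIntegral ((Spec (.of D)).residueField (π.base η)) x := IsIntegral.of_finite _ x
  have hmin := minpoly_map_ringEquiv
    (E := ↥(separableClosure ((Spec (.of D)).residueField (π.base η)) (X.residueField η)))
    (u ⟨η, hη⟩) (hu ⟨η, hη⟩) x hint
  -- splitting in `κ₁`, transported to `ResidueField B` along `e₁⁻¹`, then to `κ(𝔪_B)` along `eS⁻¹`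
  have h1 := hsplits ⟨η, hη⟩ x
  rw [← hmin, Polynomial.map_map] at h1
  have h2 := (h1.map e₁.symm.toRingEquiv.toRingHom).map eS.inv.hom
  rw [Polynomial.map_map, Polynomial.map_map] at h2
  rw [hchain]
  convert h2 using 2
  ext a
  change eS.inv.hom (algebraMap (ResidueField D) (ResidueField B) (u ⟨η, hη⟩ a)) =
    eS.inv.hom (e₁.symm (algebraMap (ResidueField D) κ₁ (u ⟨η, hη⟩ a)))
  rw [AlgEquiv.commutes]

end Choice

end Summit.ResolutionOfSingularities.ResolutionOfSingularities.Theorems.NoZeno.ExcCount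

end
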